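import Literature.Probability.Percolation.MarkedLoopTripodCuts
import Literature.Probability.Percolation.MarkedLoopCatalan
import HarnessLib

/-!
# The tripod law as a skein relation, and the rotation of the marks as a Temperley–Lieb braid generator («TRIPOD-BRAID»)

Topic `Literature/Probability/Percolation`; generic-`k` layer of the three-disorder lineage (Khristoforov–Smirnov 2021), a rider on
`MarkedLoopTripodBasis.lean` («SOLVED»: the solution space `solW k` of the TRIPOD LAW, the depth recursion `mem_solW`
`w p = −τ²·w(lo p) − τ·w(hi p)`, the outermost patterns `Pat₀ k`, `solWEquiv : solW k ≃ (Pat₀ k → ℂ)`, and `closeUp : Pat₀ k → NCMatching (k+1)` —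
close the disorder up to a NEW LAST POINT `*` of a `(k+1)`-gon), on `MarkedLoopTripodCuts.lean` (`patMap`, `solWRot`: the relabelling rotation
`rot = finRotate k` of the marks acts on `solW k` by `w ↦ w ∘ patMap rot`) and on `MarkedLoopCatalan.lean` (`IsNCMatching.partner`).

## The observation (§ Skein)
Put `A := −τ²` (`= e^{iπ/3}`, `skeinA_eq_exp`) so that `A⁻¹ = −τ` (`skeinA_mul_skeinAinv`). Then `A + A⁻¹ = 1` (`skeinA_add_skeinAinv`),
`−A² − A⁻² = 1` (`skein_loop_value`: Kauffman's loop value) and `−A³ = 1` (`skein_kink`): `A` is the value of the Kauffman bracket variable at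
which the loop value is `1` — the `O(n)` model at `n = 1`, critical percolation; `t = A⁻⁴ = e^{2πi/3}` is the point where every Jones polynomial
equals `1`. In this currency the tree's depth recursion reads `w p = A·w(lo p) + A⁻¹·w(hi p)` (`mem_solW_iff_skein`): the two descents of a
pattern through its innermost enclosing chord are the two planar smoothings of the crossing between the disorder's tail and that chord, with
Kauffman's weights — KHRISTOFOROV–SMIRNOV'S TRIPOD LAW IS THE SKEIN RELATION FOR THE DISORDER LINE AT `A = e^{iπ/3}`.

## The theorem (§ Rotation, § Polygon)
For an outermost pattern `q = (j; L)` of `k = n+1` marks: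
* `j = k−1`: `patMap rot q = (0; L+1)` is outermost (`pdepth_rotPat_of_eq`);
* `j ≠ k−1`: with `d` the partner of the last mark `k−1` (`lastMate`; depth `0` forces `j < d`, `lt_lastMate`), `patMap rot q = (j+1; L+1)` has depth
  EXACTLY ONE (`pdepth_rotPat_of_ne`) with innermost chord `(0, d+1)` (`encl_rot`, `innerPair_rot`), hence explicit descents (`loDesc_rot`,
  `hiDesc_rot`).
* ★★★ `solWRot_apply_outermost` / `solWEquiv_solWRot`: for EVERY `w ∈ solW k` and every outermost `q`,
  `(rot·w)(q) = A⁻¹ · w(gonNext q) + A · w(gonCap q)` with `gonNext q`, `gonCap q ∈ Pat₀ k` (the hi / lo descents of the rotated pattern; both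
  `= patMap rot q` when `j = k−1`, where the two terms merge by `A + A⁻¹ = 1`).
* ★★★ THE DICTIONARY WITH THE `(k+1)`-GON (§ Polygon): `closeUp (gonNext q) = relMap (finRotate (k+1)) (closeUp q)` (`closeUp_gonNext`: THE ROTATION
  OF THE POLYGON `0 → 1 → … → k−1 → * → 0`) and `closeUp (gonCap q) = tlCap (…)` (`closeUp_gonCap`), where `tlCap` is THE TEMPERLEY–LIEB GENERATOR
  `e_{*,0}` on non-crossing matchings of the polygon (cap the edge `{*, 0}` and join the former partners; `tlCapRel`, `tlCap_of_mem` — it fixes a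
  matching containing `{*, 0}`).
So, in the link basis of the `(k+1)`-gon, THE RELABELLING ROTATION OF THE `k` MARKS ACTS ON THE TRIPOD-LAW SOLUTION SPACE AS
`ρᵀ ∘ (A⁻¹·1 + A·e_{*,0})ᵀ` — the Temperley–Lieb / Jones braid generator at loop weight `1` composed with the polygon rotation (the periodic braid
`σ_{*,0}·δ` of `B_{k+1}`, whose `k`-th power is the full twist, in the Temperley–Lieb representation at `t = e^{2πi/3}`). This is the algebra
behind the lane's counts (`finrank_solW_eq_catalan`: the Temperley–Lieb module on `k+1` points; `card_pat_eq_mul_catalan`: the one-defect affine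
module) and character table (`MarkedLoopTripodCharacter`, `MarkedLoopTriangleCount`, `MarkedLoopOrderThreeModule`). The lane's exact check of the
displayed identity for `k = 3, 5, …, 13` (all `C_{l+1} × C_{l+1}` matrix entries over `ℤ[τ]`) is `HOME/FINDING-TRIPOD-SKEIN.md`.

Status in print (lane literature desk, corpus + galaxy, 2026-08-26): the skein constants (`A = e^{iπ/3}`: `A + A⁻¹ = 1 = −A² − A⁻²`, `−A³ = 1`) and the
braid-generator form `g = A^{∓1} + A^{±1}e` are classical (Kauffman, *Knots and Physics*, Cor. 3.4, §7; Chmutov–Duzhin–Mostovoy Ex. 2.21: the Jones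
polynomial is `1` at `t = e^{2πi/3}`); discrete holomorphicity of loop-model observables from Yang–Baxter / quantum-affine Temperley–Lieb structure is
printed (Cardy 2009; Ikhlef–Cardy 2009; Ikhlef–Weston–Wheeler–Zinn-Justin 2013); link patterns of multi-disorder loop configurations appear in
Khristoforov–Skopenkov–Smirnov (2025) and a paper «Smirnov's observable and link pattern probabilities in percolation» is announced in Khristoforov–Smirnov
(2021, ref. [KK]). Khristoforov–Smirnov treat `k = 3` (Definition 3, Lemma 4); the `k`-disorder tripod law, its solution space and the rotation action are
the lane's (tree files above). The identification of the tripod law with the Kauffman skein relation at `A = e^{iπ/3}`, and of the mark rotation on the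
solution space with the Temperley–Lieb braid generator times the polygon rotation in the link-pattern basis, as exact statements for all odd `k` (this
file), was not located in print. Nothing from the cited knot-theory sources is used in the proofs.

## References
* M. Khristoforov, S. Smirnov, *Percolation and O(1) loop model*, arXiv:2111.15612 (2021), §1.2 (arXiv v1 p. 2: link patterns, cyclic indexing),
  §2 Definition 3 and Lemma 4 with its proof and Fig. 3 (p. 4).
* L. H. Kauffman, *Knots and Physics*, World Scientific (1991), Part I §3 (Cor. 3.4, Prop. 3.5: `B = A⁻¹`, `d = −A² − A⁻²`, `Ad + B = −A³`) and §7
  (the bracket for braids: `ρ(σ_i) = A + A⁻¹U_i`, the Temperley–Lieb relations, Prop. 7.4 / 7.5).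
* S. Chmutov, S. Duzhin, J. Mostovoy, *Introduction to Vassiliev Knot Invariants*, CUP (2012), Exercise 2.21 (p. 53: the bracket at `a = e^{πi/3}`,
  `J(L)|_{t = e^{2πi/3}} = 1`).
* Background (docstring prose only): W. B. R. Lickorish, K. C. Millett, Comment. Math. Helv. 61 (1986) 349–359; J. Cardy, arXiv:0907.4070 (2009) and
  Y. Ikhlef, J. Cardy, J. Phys. A 42 (2009) 102001 (discrete holomorphicity from Yang–Baxter / Temperley–Lieb structure); Y. Ikhlef, R. Weston,
  M. Wheeler, P. Zinn-Justin, arXiv:1302.4649 (2013); M. Khristoforov, M. Skopenkov, S. Smirnov, CMP (2025) (link patterns of multi-disorder configurations);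
  Khristoforov–Kleptsyn, *Smirnov's observable and link pattern probabilities in percolation* (announced in KhS 2021 as [KK], in preparation).

## Mathlib / tree
Tree: `MarkedLoopTripodBasis.lean` (`IsPattern`, `encl`, `innerPair_spec`, `loDesc`, `hiDesc`, `Pat`, `Pat.lo/hi`, `Pat₀`, `mem_solW`, `solWEquiv`,
`liftRel`, `closeUpRel`, `closeUp`, `depth_eq_zero_iff`), `MarkedLoopTripodCuts.lean` (`patMap`, `patMap_val`, `solWRot_apply`), `MarkedLoopRotation.lean`
(`rot`, `isCyc_rot`, `relMap`, `mem_relMap`, `relMap_withPair`), `MarkedLoopCatalan.lean` (`IsNCMatching.partner`, `eq_partner`), `MarkedLoopHolomorphy.lean`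
(`withPair`, `mem_withPair`). Mathlib: `finRotate_last`, `coe_finRotate_of_ne_last`, `Complex.exp_add`, `Complex.exp_pi_mul_I`.
-/

open Finset

namespace Literature.Probability.Percolation.MarkedLoops

open Literature.Probability.Percolation.FivePoint (tau)

/-! ### § Skein — the constants `A = −τ²`, `A⁻¹ = −τ` -/

section Skein

/-- `1 + τ + τ² = 0` (in the tree under several private names; re-derived for import economy). [folklore] -/
private theorem tau_sum_braid : 1 + tau + tau ^ 2 = 0 := by
  have hprim : IsPrimitiveRoot tau 3 := by
    have h := Complex.isPrimitiveRoot_exp 3 (by norm_num)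
    unfold tau
    convert h using 2
    push_cast
    ring
  have h := hprim.geom_sum_eq_zero (by norm_num : 1 < 3)
  simp only [Finset.sum_range_succ, Finset.sum_range_zero, pow_zero, pow_one, zero_add] at h
  linear_combination h

/-- ★ `A·A⁻¹ = 1` for `A = −τ²`, `A⁻¹ = −τ` (`τ³ = 1`). [cite: Kauffman1991KnotsPhysics, Part I §3 Cor. 3.4 and Prop. 3.5 (B = A⁻¹, d = −A² − A⁻², −A³); KhristoforovSmirnov2021, §2 Definition 3 (arXiv v1 p. 4: `τ = e^{2πi/3}`)] -/
theorem skeinA_mul_skeinAinv : (-tau ^ 2) * (-tau) = 1 := by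
  linear_combination (tau - 1) * tau_sum_braid

/-- ★ **`A + A⁻¹ = 1`**: `−τ² − τ = 1` — the two skein weights of the tripod law sum to one.
[cite: Kauffman1991KnotsPhysics, Part I §3 Cor. 3.4 and Prop. 3.5 (B = A⁻¹, d = −A² − A⁻², −A³); KhristoforovSmirnov2021, §2 Definition 3 and Lemma 4 (arXiv v1 p. 4)] -/
theorem skeinA_add_skeinAinv : -tau ^ 2 + -tau = 1 := by
  linear_combination (-1 : ℂ) * tau_sum_braid

/-- ★ **the loop value is one**: `−A² − A⁻² = 1` for `A = −τ²` (Kauffman's `d = −A² − A⁻²` at the percolation point `n = 1`).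
[cite: Kauffman1991KnotsPhysics, Part I §3 Cor. 3.4 and Prop. 3.5 (B = A⁻¹, d = −A² − A⁻², −A³); ChmutovDuzhinMostovoy2012, Exercise 2.21 (p. 53); KhristoforovSmirnov2021, §1 (arXiv v1 p. 1: the `O(1)` loop model)] -/
theorem skein_loop_value : -(-tau ^ 2) ^ 2 - (-tau) ^ 2 = 1 := by
  linear_combination (-tau ^ 2 + tau - 1) * tau_sum_braid

/-- ★ **no kink phase**: `−A³ = 1` for `A = −τ²`. [cite: Kauffman1991KnotsPhysics, Part I §3 Cor. 3.4 and Prop. 3.5 (B = A⁻¹, d = −A² − A⁻², −A³); KhristoforovSmirnov2021, §2 Definition 3 (arXiv v1 p. 4)] -/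
theorem skein_kink : -(-tau ^ 2) ^ 3 = 1 := by
  linear_combination (tau - 1) * (tau ^ 3 + 1) * tau_sum_braid

/-- ★ `A = −τ² = e^{iπ/3}`. [cite: ChmutovDuzhinMostovoy2012, Exercise 2.21 (p. 53: `a = e^{πi/3}`); KhristoforovSmirnov2021, §2 Definition 3 (arXiv v1 p. 4: `τ = e^{2πi/3}`)] -/
theorem skeinA_eq_exp : -tau ^ 2 = Complex.exp (Real.pi * Complex.I / 3) := by
  have h3 : Complex.exp (2 * Real.pi * Complex.I / 3) ^ 2 = Complex.exp (Real.pi * Complex.I / 3) * Complex.exp (Real.pi * Complex.I) := by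
    rw [sq, ← Complex.exp_add, ← Complex.exp_add]
    congr 1
    ring
  unfold tau
  rw [h3, Complex.exp_pi_mul_I]
  ring

variable {nm : ℕ}

/-- ★★ **THE TRIPOD LAW IS THE SKEIN RELATION**: `w ∈ solW k` iff `w p = A·w(lo p) + A⁻¹·w(hi p)` at every pattern of positive depth, `A = −τ²`,
`A⁻¹ = −τ` — the tree's depth recursion `mem_solW` in Kauffman's currency. [cite: KhristoforovSmirnov2021, §2 Lemma 4, proof and Fig. 3 (arXiv v1 p. 4)] -/
theorem mem_solW_iff_skein {w : Pat nm → ℂ} :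
    w ∈ solW nm ↔ ∀ p : Pat nm, 0 < p.pdepth → w p = (-tau ^ 2) * w p.lo + (-tau) * w p.hi := by
  rw [mem_solW]
  refine forall₂_congr fun p _ => ?_
  constructor <;> intro h <;> rw [h] <;> ring

end Skein

/-! ### § Rotation — the rotated outermost pattern -/

section Rotation

variable {n : ℕ}

/-- the rotation sends the last mark to `0`. [cite: KhristoforovSmirnov2021, §1.2 (arXiv v1 p. 2: counterclockwise cyclic indexing)] -/
theorem rot_last : rot (n + 1) (Fin.last n) = 0 := finRotate_last

/-- the inverse rotation sends `0` to the last mark. [cite: KhristoforovSmirnov2021, §1.2 (arXiv v1 p. 2)] -/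
theorem rot_symm_zero : (rot (n + 1)).symm 0 = Fin.last n := by
  rw [Equiv.symm_apply_eq]; exact rot_last.symm

/-- the value of a rotated non-last mark. [cite: KhristoforovSmirnov2021, §1.2 (arXiv v1 p. 2)] -/
theorem val_rot_of_ne_last {i : Fin (n + 1)} (hi : i ≠ Fin.last n) : ((rot (n + 1) i : Fin (n + 1)) : ℕ) = i.val + 1 :=
  coe_finRotate_of_ne_last hi

/-- a rotated mark is `0` iff the mark was the last one. [cite: KhristoforovSmirnov2021, §1.2 (arXiv v1 p. 2)] -/
theorem rot_eq_zero_iff {i : Fin (n + 1)} : rot (n + 1) i = 0 ↔ i = Fin.last n := by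
  constructor
  · intro h
    by_contra hi
    have := val_rot_of_ne_last hi
    rw [h, Fin.val_zero] at this
    omega
  · rintro rfl; exact rot_last

variable {j : Fin (n + 1)} {L : Finset (Fin (n + 1) × Fin (n + 1))}

/-- **the partner of the last mark** in a pattern whose disorder partner is not the last mark. [cite: KhristoforovSmirnov2021, §1.2 (arXiv v1 p. 2: «matching marked points»)] -/
noncomputable def lastMate (hP : IsPattern j L) (hj : j ≠ Fin.last n) : Fin (n + 1) :=
  (hP.perfect (Fin.last n) (Ne.symm hj)).exists.choose

/-- the partner of the last mark is linked to it. [cite: KhristoforovSmirnov2021, §1.2 (arXiv v1 p. 2)] -/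
theorem lastMate_mem (hP : IsPattern j L) (hj : j ≠ Fin.last n) : (Fin.last n, lastMate hP hj) ∈ L :=
  (hP.perfect (Fin.last n) (Ne.symm hj)).exists.choose_spec

/-- uniqueness of the partner of the last mark. [cite: KhristoforovSmirnov2021, §1.2 (arXiv v1 p. 2)] -/
theorem eq_lastMate (hP : IsPattern j L) (hj : j ≠ Fin.last n) {d : Fin (n + 1)} (hd : (Fin.last n, d) ∈ L) : d = lastMate hP hj :=
  hP.partner_eq hd (lastMate_mem hP hj)

/-- the partner of the last mark is not the last mark. [cite: KhristoforovSmirnov2021, §1.2 (arXiv v1 p. 2)] -/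
theorem lastMate_ne_last (hP : IsPattern j L) (hj : j ≠ Fin.last n) : lastMate hP hj ≠ Fin.last n :=
  fun e => hP.irrefl _ (by simpa only [e] using lastMate_mem hP hj)

/-- the partner of the last mark is not the disorder's partner. [cite: KhristoforovSmirnov2021, §1.2 (arXiv v1 p. 2)] -/
theorem lastMate_ne (hP : IsPattern j L) (hj : j ≠ Fin.last n) : lastMate hP hj ≠ j :=
  hP.off₂ (lastMate_mem hP hj)

/-- ★ **in an OUTERMOST pattern the last mark's chord lies beyond the disorder's partner**: `j < d`.
[cite: KhristoforovSmirnov2021, §1.2 (arXiv v1 p. 2: «disjoint paths»)] -/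
theorem lt_lastMate (hP : IsPattern j L) (hj : j ≠ Fin.last n) (h0 : depth j L = 0) : j < lastMate hP hj := by
  rcases lt_or_gt_of_ne (lastMate_ne hP hj) with h | h
  · exfalso
    rw [depth_eq_zero_iff] at h0
    exact h0 _ (hP.symm _ _ (lastMate_mem hP hj)) ⟨h, Fin.lt_last_iff_ne_last.2 hj⟩
  · exact h

/-- ★ **the rotated outermost pattern has exactly one enclosing chord, `(0, d+1)`** (`j ≠ k−1`).
[cite: KhristoforovSmirnov2021, §1.2 (arXiv v1 p. 2: the link pattern, cyclic indexing)] -/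
theorem encl_rot (hP : IsPattern j L) (hj : j ≠ Fin.last n) (h0 : depth j L = 0) :
    encl (rot (n + 1) j) (relMap (rot (n + 1)) L) = {((0 : Fin (n + 1)), rot (n + 1) (lastMate hP hj))} := by
  have hd := lastMate_mem hP hj
  have hdl := lastMate_ne_last hP hj
  have hjd := lt_lastMate hP hj h0
  rw [depth_eq_zero_iff] at h0
  have hjv := val_rot_of_ne_last hj
  ext ⟨x, y⟩
  rw [mem_encl, mem_relMap, Finset.mem_singleton, Prod.mk.injEq]
  simp only
  constructor
  · rintro ⟨hxy, hx, hy⟩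
    obtain ⟨a, rfl⟩ : ∃ a, x = rot (n + 1) a := ⟨(rot (n + 1)).symm x, ((rot (n + 1)).apply_symm_apply x).symm⟩
    obtain ⟨b, rfl⟩ : ∃ b, y = rot (n + 1) b := ⟨(rot (n + 1)).symm y, ((rot (n + 1)).apply_symm_apply y).symm⟩
    rw [Equiv.symm_apply_apply, Equiv.symm_apply_apply] at hxy
    by_cases hal : a = Fin.last n
    · refine ⟨by rw [hal, rot_last], ?_⟩
      rw [hal] at hxy
      rw [eq_lastMate hP hj hxy]
    · exfalso
      have hav := val_rot_of_ne_last hal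
      by_cases hbl : b = Fin.last n
      · rw [hbl, rot_last] at hy
        exact (Fin.not_lt_zero _) hy
      · have hbv := val_rot_of_ne_last hbl
        refine h0 _ hxy ⟨?_, ?_⟩
        · show a < j
          rw [Fin.lt_def] at hx ⊢; omega
        · show j < b
          rw [Fin.lt_def] at hy ⊢; omega
  · rintro ⟨rfl, rfl⟩
    refine ⟨?_, ?_, ?_⟩
    · rw [rot_symm_zero, Equiv.symm_apply_apply]; exact hd
    · rw [Fin.lt_def, Fin.val_zero, hjv]; omega
    · rw [Fin.lt_def, hjv, val_rot_of_ne_last hdl]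
      exact Nat.succ_lt_succ (Fin.lt_def.1 hjd)

/-- ★ **depth exactly one** after the rotation (`j ≠ k−1`). [cite: KhristoforovSmirnov2021, §1.2 (arXiv v1 p. 2)] -/
theorem depth_rot (hP : IsPattern j L) (hj : j ≠ Fin.last n) (h0 : depth j L = 0) :
    depth (rot (n + 1) j) (relMap (rot (n + 1)) L) = 1 := by
  rw [depth_eq_card_encl, encl_rot hP hj h0, Finset.card_singleton]

/-- ★ **the innermost chord of the rotated outermost pattern is `(0, d+1)`.** [cite: KhristoforovSmirnov2021, §1.2 (arXiv v1 p. 2)] -/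
theorem innerPair_rot (hP : IsPattern j L) (hj : j ≠ Fin.last n) (h0 : depth j L = 0) :
    innerPair (rot (n + 1) j) (relMap (rot (n + 1)) L) = ((0 : Fin (n + 1)), rot (n + 1) (lastMate hP hj)) := by
  have h := (innerPair_spec (j := rot (n + 1) j) (L := relMap (rot (n + 1)) L) (by rw [depth_rot hP hj h0]; exact one_pos)).1
  rwa [encl_rot hP hj h0, Finset.mem_singleton] at h

/-- the lo descent of the rotated outermost pattern: the disorder goes to `0`, the chord `{j+1, d+1}` appears.
[cite: KhristoforovSmirnov2021, §2 Lemma 4, proof and Fig. 3 (arXiv v1 p. 4)] -/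
theorem loDesc_rot (hP : IsPattern j L) (hj : j ≠ Fin.last n) (h0 : depth j L = 0) :
    loDesc (rot (n + 1) j) (relMap (rot (n + 1)) L) =
      ((0 : Fin (n + 1)), withPair (strip (relMap (rot (n + 1)) L) 0 (rot (n + 1) (lastMate hP hj))) (rot (n + 1) j) (rot (n + 1) (lastMate hP hj))) := by
  unfold loDesc; rw [innerPair_rot hP hj h0]

/-- the hi descent of the rotated outermost pattern: the disorder goes to `d+1`, the chord `{0, j+1}` appears.
[cite: KhristoforovSmirnov2021, §2 Lemma 4, proof and Fig. 3 (arXiv v1 p. 4)] -/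
theorem hiDesc_rot (hP : IsPattern j L) (hj : j ≠ Fin.last n) (h0 : depth j L = 0) :
    hiDesc (rot (n + 1) j) (relMap (rot (n + 1)) L) =
      (rot (n + 1) (lastMate hP hj), withPair (strip (relMap (rot (n + 1)) L) 0 (rot (n + 1) (lastMate hP hj))) 0 (rot (n + 1) j)) := by
  unfold hiDesc; rw [innerPair_rot hP hj h0]

/-- when the disorder's partner IS the last mark, the rotated pattern is outermost. [cite: KhristoforovSmirnov2021, §1.2 (arXiv v1 p. 2)] -/
theorem depth_rot_of_eq_last (L : Finset (Fin (n + 1) × Fin (n + 1))) :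
    depth (rot (n + 1) (Fin.last n)) (relMap (rot (n + 1)) L) = 0 := by
  rw [rot_last, depth_eq_zero_iff]
  rintro cd - ⟨h, -⟩
  exact (Fin.not_lt_zero _) h

/-- **the rotated pattern** `patMap rot q` of an outermost pattern `q`. [cite: KhristoforovSmirnov2021, §1.2 (arXiv v1 p. 2: cyclic indexing)] -/
noncomputable abbrev rotPat (q : Pat₀ (n + 1)) : Pat (n + 1) := patMap (rot (n + 1)) isCyc_rot q.1

/-- the rotated pattern, unfolded. [cite: KhristoforovSmirnov2021, §1.2 (arXiv v1 p. 2)] -/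
theorem rotPat_val (q : Pat₀ (n + 1)) : (rotPat q).1 = (rot (n + 1) q.1.1.1, relMap (rot (n + 1)) q.1.1.2) := patMap_val _ _ _

/-- depth zero after rotation when `j = k−1`. [cite: KhristoforovSmirnov2021, §1.2 (arXiv v1 p. 2)] -/
theorem pdepth_rotPat_of_eq (q : Pat₀ (n + 1)) (hj : q.1.1.1 = Fin.last n) : (rotPat q).pdepth = 0 := by
  show depth (rot (n + 1) q.1.1.1) (relMap (rot (n + 1)) q.1.1.2) = 0
  rw [hj]; exact depth_rot_of_eq_last _

/-- ★ depth exactly one after rotation when `j ≠ k−1`. [cite: KhristoforovSmirnov2021, §1.2 (arXiv v1 p. 2)] -/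
theorem pdepth_rotPat_of_ne (q : Pat₀ (n + 1)) (hj : q.1.1.1 ≠ Fin.last n) : (rotPat q).pdepth = 1 :=
  depth_rot q.1.2 hj q.2

/-- ★ **the polygon successor** of an outermost pattern: the hi descent of the rotated pattern (`j ≠ k−1`), the rotated pattern itself (`j = k−1`) —
under `closeUp` this is the ROTATION OF THE `(k+1)`-GON (`closeUp_gonNext`). [cite: KhristoforovSmirnov2021, §1.2 (arXiv v1 p. 2: cyclic indexing)] -/
noncomputable def gonNext (q : Pat₀ (n + 1)) : Pat₀ (n + 1) :=
  if hj : q.1.1.1 = Fin.last n then ⟨rotPat q, pdepth_rotPat_of_eq q hj⟩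
  else ⟨(rotPat q).hi, by
    have h1 := pdepth_rotPat_of_ne q hj
    have := (rotPat q).pdepth_hi (by rw [h1]; exact one_pos)
    omega⟩

/-- ★ **the capped polygon successor**: the lo descent of the rotated pattern (`j ≠ k−1`), the rotated pattern itself (`j = k−1`) — under `closeUp`
this is the TEMPERLEY–LIEB GENERATOR `e_{*,0}` applied to the rotated matching (`closeUp_gonCap`). [cite: KhristoforovSmirnov2021, §1.2 (arXiv v1 p. 2)] -/
noncomputable def gonCap (q : Pat₀ (n + 1)) : Pat₀ (n + 1) :=
  if hj : q.1.1.1 = Fin.last n then ⟨rotPat q, pdepth_rotPat_of_eq q hj⟩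
  else ⟨(rotPat q).lo, by
    have h1 := pdepth_rotPat_of_ne q hj
    have := (rotPat q).pdepth_lo (by rw [h1]; exact one_pos)
    omega⟩

/-- `gonNext` when `j = k−1`. [cite: KhristoforovSmirnov2021, §1.2 (arXiv v1 p. 2)] -/
theorem gonNext_of_eq (q : Pat₀ (n + 1)) (hj : q.1.1.1 = Fin.last n) : (gonNext q).1 = rotPat q := by
  unfold gonNext; rw [dif_pos hj]

/-- `gonCap` when `j = k−1`. [cite: KhristoforovSmirnov2021, §1.2 (arXiv v1 p. 2)] -/
theorem gonCap_of_eq (q : Pat₀ (n + 1)) (hj : q.1.1.1 = Fin.last n) : (gonCap q).1 = rotPat q := by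
  unfold gonCap; rw [dif_pos hj]

/-- `gonNext` when `j ≠ k−1`. [cite: KhristoforovSmirnov2021, §1.2 (arXiv v1 p. 2)] -/
theorem gonNext_of_ne (q : Pat₀ (n + 1)) (hj : q.1.1.1 ≠ Fin.last n) : (gonNext q).1 = (rotPat q).hi := by
  unfold gonNext; rw [dif_neg hj]

/-- `gonCap` when `j ≠ k−1`. [cite: KhristoforovSmirnov2021, §1.2 (arXiv v1 p. 2)] -/
theorem gonCap_of_ne (q : Pat₀ (n + 1)) (hj : q.1.1.1 ≠ Fin.last n) : (gonCap q).1 = (rotPat q).lo := by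
  unfold gonCap; rw [dif_neg hj]

/-- the underlying pair of `gonNext q` (`j ≠ k−1`): disorder at `d+1`, chord `{0, j+1}`. [cite: KhristoforovSmirnov2021, §1.2 (arXiv v1 p. 2)] -/
theorem gonNext_val_of_ne (q : Pat₀ (n + 1)) (hj : q.1.1.1 ≠ Fin.last n) :
    (gonNext q).1.1 = (rot (n + 1) (lastMate q.1.2 hj),
      withPair (strip (relMap (rot (n + 1)) q.1.1.2) 0 (rot (n + 1) (lastMate q.1.2 hj))) 0 (rot (n + 1) q.1.1.1)) := by
  rw [gonNext_of_ne q hj, Pat.hi_val _ (by rw [pdepth_rotPat_of_ne q hj]; exact one_pos)]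
  exact hiDesc_rot q.1.2 hj q.2

/-- the underlying pair of `gonCap q` (`j ≠ k−1`): disorder at `0`, chord `{j+1, d+1}`. [cite: KhristoforovSmirnov2021, §1.2 (arXiv v1 p. 2)] -/
theorem gonCap_val_of_ne (q : Pat₀ (n + 1)) (hj : q.1.1.1 ≠ Fin.last n) :
    (gonCap q).1.1 = ((0 : Fin (n + 1)),
      withPair (strip (relMap (rot (n + 1)) q.1.1.2) 0 (rot (n + 1) (lastMate q.1.2 hj))) (rot (n + 1) q.1.1.1) (rot (n + 1) (lastMate q.1.2 hj))) := by
  rw [gonCap_of_ne q hj, Pat.lo_val _ (by rw [pdepth_rotPat_of_ne q hj]; exact one_pos)]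
  exact loDesc_rot q.1.2 hj q.2

/-- ★★★ **THE ROTATION OF THE MARKS IN THE OUTERMOST BASIS IS THE SKEIN COMBINATION `A⁻¹·(next) + A·(cap ∘ next)`**: for every tripod-law
solution `w ∈ solW k` and every outermost pattern `q`, `(w ∘ patMap rot)(q) = (−τ)·w(gonNext q) + (−τ²)·w(gonCap q)` — with `closeUp_gonNext` /
`closeUp_gonCap`: THE MARK ROTATION IS THE TEMPERLEY–LIEB BRAID GENERATOR `A⁻¹·1 + A·e_{*,0}` AT LOOP WEIGHT ONE TIMES THE ROTATION OF THE
`(k+1)`-GON. [cite: KhristoforovSmirnov2021, §2 Lemma 4, proof and Fig. 3 (arXiv v1 p. 4); §1.2 (p. 2: cyclic indexing)] -/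
theorem solWRot_apply_outermost (w : solW (n + 1)) (q : Pat₀ (n + 1)) :
    (solWRot (n + 1) (rot (n + 1)) isCyc_rot w : Pat (n + 1) → ℂ) q.1 = (-tau) * w.1 (gonNext q).1 + (-tau ^ 2) * w.1 (gonCap q).1 := by
  rw [solWRot_apply]
  by_cases hj : q.1.1.1 = Fin.last n
  · rw [gonNext_of_eq q hj, gonCap_of_eq q hj]
    linear_combination (w.1 (rotPat q)) * tau_sum_braid
  · rw [gonNext_of_ne q hj, gonCap_of_ne q hj]
    have hpos : 0 < (rotPat q).pdepth := by rw [pdepth_rotPat_of_ne q hj]; exact one_pos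
    rw [w.2 (rotPat q) hpos]
    ring

/-- ★★★ the same in the coordinates `solWEquiv : solW k ≃ (Pat₀ k → ℂ)`: the matrix of the mark rotation in the outermost basis has the entries
`−τ` at `(q, gonNext q)` and `−τ²` at `(q, gonCap q)` (merged to `1` when they coincide). [cite: KhristoforovSmirnov2021, §2 Lemma 4 (arXiv v1 p. 4); §1.2 (p. 2)] -/
theorem solWEquiv_solWRot (w : solW (n + 1)) (q : Pat₀ (n + 1)) :
    solWEquiv (n + 1) (solWRot (n + 1) (rot (n + 1)) isCyc_rot w) q =
      (-tau) * solWEquiv (n + 1) w (gonNext q) + (-tau ^ 2) * solWEquiv (n + 1) w (gonCap q) := by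
  rw [solWEquiv_apply, solWEquiv_apply, solWEquiv_apply]
  exact solWRot_apply_outermost w q

/-- when the disorder's partner is the last mark the two terms merge (`A + A⁻¹ = 1`): `(w ∘ patMap rot)(q) = w(gonNext q)`.
[cite: KhristoforovSmirnov2021, §2 Lemma 4 (arXiv v1 p. 4); §1.2 (p. 2)] -/
theorem solWRot_apply_outermost_of_eq (w : solW (n + 1)) (q : Pat₀ (n + 1)) (hj : q.1.1.1 = Fin.last n) :
    (solWRot (n + 1) (rot (n + 1)) isCyc_rot w : Pat (n + 1) → ℂ) q.1 = w.1 (gonNext q).1 := by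
  rw [solWRot_apply, gonNext_of_eq q hj]

end Rotation

/-! ### § Polygon — the dictionary with the non-crossing matchings of the `(k+1)`-gon -/

section Polygon

variable {n : ℕ}

/-- membership in the tree's `liftRel` (its own lemma is private). [folklore] -/
private theorem mem_liftRel_braid {L : Finset (Fin (n + 1) × Fin (n + 1))} {x y : Fin (n + 1 + 1)} :
    (x, y) ∈ liftRel L ↔ ∃ a b : Fin (n + 1), (a, b) ∈ L ∧ Fin.castSucc a = x ∧ Fin.castSucc b = y := by
  unfold liftRel
  rw [Finset.mem_image]
  constructor
  · rintro ⟨⟨a, b⟩, hab, h⟩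
    exact ⟨a, b, hab, (Prod.mk.inj h).1, (Prod.mk.inj h).2⟩
  · rintro ⟨a, b, hab, rfl, rfl⟩
    exact ⟨(a, b), hab, rfl⟩

/-- membership in the tree's `strip` (its own lemma is private). [folklore] -/
private theorem mem_strip_braid {m : ℕ} {L : Finset (Fin m × Fin m)} {a b x y : Fin m} :
    (x, y) ∈ strip L a b ↔ (x, y) ∈ L ∧ ¬ (x = a ∧ y = b) ∧ ¬ (x = b ∧ y = a) := by
  unfold strip
  rw [Finset.mem_erase, Finset.mem_erase, Ne, Ne, Prod.mk.injEq, Prod.mk.injEq]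
  tauto

/-- `withPair` is symmetric in the chord's endpoints. [cite: KhristoforovSmirnov2021, §1.2 (arXiv v1 p. 2: link patterns); lane plumbing] -/
theorem withPair_comm {m : ℕ} (L : Finset (Fin m × Fin m)) (a b : Fin m) : withPair L a b = withPair L b a := by
  ext ⟨x, y⟩; rw [mem_withPair, mem_withPair]; tauto

/-- two added chords commute. [cite: KhristoforovSmirnov2021, §1.2 (arXiv v1 p. 2: link patterns); lane plumbing] -/
theorem withPair_right_comm {m : ℕ} (L : Finset (Fin m × Fin m)) (a b c e : Fin m) :
    withPair (withPair L a b) c e = withPair (withPair L c e) a b := by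
  ext ⟨x, y⟩; rw [mem_withPair, mem_withPair, mem_withPair, mem_withPair]; tauto

/-- putting a stripped chord back (the tree's private `withPair_strip`). [folklore] -/
private theorem withPair_strip_braid {m : ℕ} {L : Finset (Fin m × Fin m)} {a b : Fin m} (hab : (a, b) ∈ L) (hba : (b, a) ∈ L) :
    withPair (strip L a b) b a = L := by
  ext ⟨x, y⟩
  rw [mem_withPair, mem_strip_braid]
  constructor
  · rintro (⟨rfl, rfl⟩ | ⟨rfl, rfl⟩ | ⟨h, -, -⟩)
    · exact hba
    · exact hab
    · exact h
  · intro h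
    by_cases h1 : x = b ∧ y = a
    · exact Or.inl h1
    by_cases h2 : x = a ∧ y = b
    · exact Or.inr (Or.inl h2)
    · exact Or.inr (Or.inr ⟨h, h2, h1⟩)

/-- transporting a stripped relation. [cite: KhristoforovSmirnov2021, §1.2 (arXiv v1 p. 2: cyclic indexing)] -/
theorem relMap_strip {m : ℕ} (σ : Equiv.Perm (Fin m)) (L : Finset (Fin m × Fin m)) (a b : Fin m) :
    relMap σ (strip L a b) = strip (relMap σ L) (σ a) (σ b) := by
  ext ⟨x, y⟩
  rw [mem_relMap, mem_strip_braid, mem_strip_braid, mem_relMap, Equiv.symm_apply_eq, Equiv.symm_apply_eq, Equiv.symm_apply_eq,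
    Equiv.symm_apply_eq]

/-- lifting commutes with adding a chord. [cite: KhristoforovSmirnov2021, §1.2 (arXiv v1 p. 2: link patterns); lane plumbing] -/
theorem liftRel_withPair (L : Finset (Fin (n + 1) × Fin (n + 1))) (a b : Fin (n + 1)) :
    liftRel (withPair L a b) = withPair (liftRel L) (Fin.castSucc a) (Fin.castSucc b) := by
  ext ⟨x, y⟩
  rw [mem_liftRel_braid, mem_withPair]
  constructor
  · rintro ⟨a', b', h, rfl, rfl⟩
    rw [mem_withPair] at h
    rcases h with ⟨rfl, rfl⟩ | ⟨rfl, rfl⟩ | h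
    · exact Or.inl ⟨rfl, rfl⟩
    · exact Or.inr (Or.inl ⟨rfl, rfl⟩)
    · exact Or.inr (Or.inr (mem_liftRel_braid.2 ⟨a', b', h, rfl, rfl⟩))
  · rintro (⟨rfl, rfl⟩ | ⟨rfl, rfl⟩ | h)
    · exact ⟨a, b, mem_withPair.2 (Or.inl ⟨rfl, rfl⟩), rfl, rfl⟩
    · exact ⟨b, a, mem_withPair.2 (Or.inr (Or.inl ⟨rfl, rfl⟩)), rfl, rfl⟩
    · obtain ⟨a', b', h', rfl, rfl⟩ := mem_liftRel_braid.1 h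
      exact ⟨a', b', mem_withPair.2 (Or.inr (Or.inr h')), rfl, rfl⟩

/-- **the polygon rotation of a lifted non-last mark is the lift of the rotated mark.** [cite: KhristoforovSmirnov2021, §1.2 (arXiv v1 p. 2: cyclic indexing)] -/
theorem rot_castSucc {a : Fin (n + 1)} (ha : a ≠ Fin.last n) :
    rot (n + 1 + 1) (Fin.castSucc a) = Fin.castSucc (rot (n + 1) a) := by
  apply Fin.ext
  rw [Fin.val_castSucc, val_rot_of_ne_last ha, val_rot_of_ne_last (Fin.castSucc_lt_last a).ne, Fin.val_castSucc]

/-- **the polygon rotation sends the lifted last mark to the new point `*`.** [cite: KhristoforovSmirnov2021, §1.2 (arXiv v1 p. 2)] -/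
theorem rot_castSucc_last : rot (n + 1 + 1) (Fin.castSucc (Fin.last n)) = Fin.last (n + 1) := by
  apply Fin.ext
  rw [val_rot_of_ne_last (Fin.castSucc_lt_last _).ne, Fin.val_castSucc, Fin.val_last, Fin.val_last]

/-- **the polygon rotation sends `*` to `0`.** [cite: KhristoforovSmirnov2021, §1.2 (arXiv v1 p. 2)] -/
theorem rot_star : rot (n + 1 + 1) (Fin.last (n + 1)) = 0 := rot_last

/-- ★ **lifting intertwines the rotation of the marks with the rotation of the polygon**, on relations avoiding the last mark.
[cite: KhristoforovSmirnov2021, §1.2 (arXiv v1 p. 2: cyclic indexing)] -/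
theorem liftRel_relMap_rot {L : Finset (Fin (n + 1) × Fin (n + 1))} (hL : ∀ ab ∈ L, ab.1 ≠ Fin.last n ∧ ab.2 ≠ Fin.last n) :
    liftRel (relMap (rot (n + 1)) L) = relMap (rot (n + 1 + 1)) (liftRel L) := by
  ext ⟨x, y⟩
  rw [mem_liftRel_braid, mem_relMap, mem_liftRel_braid]
  constructor
  · rintro ⟨a', b', hab, rfl, rfl⟩
    rw [mem_relMap] at hab
    obtain ⟨ha, hb⟩ := hL _ hab
    refine ⟨(rot (n + 1)).symm a', (rot (n + 1)).symm b', hab, ?_, ?_⟩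
    · rw [Equiv.eq_symm_apply, rot_castSucc ha, Equiv.apply_symm_apply]
    · rw [Equiv.eq_symm_apply, rot_castSucc hb, Equiv.apply_symm_apply]
  · rintro ⟨a, b, hab, ha, hb⟩
    obtain ⟨hal, hbl⟩ := hL _ hab
    refine ⟨rot (n + 1) a, rot (n + 1) b, mem_relMap_apply.2 hab, ?_, ?_⟩
    · rw [← rot_castSucc hal, ha, Equiv.apply_symm_apply]
    · rw [← rot_castSucc hbl, hb, Equiv.apply_symm_apply]

/-- the closed-up relation of an outermost pattern, unfolded. [cite: KhristoforovSmirnov2021, §1.2 (arXiv v1 p. 2)] -/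
theorem closeUp_val (q : Pat₀ (n + 1)) : (closeUp q).1 = withPair (liftRel q.1.1.2) (Fin.castSucc q.1.1.1) (Fin.last (n + 1)) := rfl

/-- the relation of a pattern avoids the disorder's partner on both sides. [cite: KhristoforovSmirnov2021, §1.2 (arXiv v1 p. 2)] -/
theorem IsPattern.avoids {j : Fin (n + 1)} {L : Finset (Fin (n + 1) × Fin (n + 1))} (hP : IsPattern j L) :
    ∀ ab ∈ L, ab.1 ≠ j ∧ ab.2 ≠ j := fun ab h => ⟨hP.off ab.1 ab.2 h, hP.off₂ h⟩

/-- after stripping the last mark's chord, the relation avoids the last mark. [cite: KhristoforovSmirnov2021, §1.2 (arXiv v1 p. 2)] -/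
theorem strip_avoids_last {j : Fin (n + 1)} {L : Finset (Fin (n + 1) × Fin (n + 1))} (hP : IsPattern j L) (hj : j ≠ Fin.last n) :
    ∀ ab ∈ strip L (Fin.last n) (lastMate hP hj), ab.1 ≠ Fin.last n ∧ ab.2 ≠ Fin.last n := by
  rintro ⟨a, b⟩ h
  rw [mem_strip_braid] at h
  obtain ⟨hab, h1, h2⟩ := h
  refine ⟨fun ha => h1 ⟨ha, ?_⟩, fun hb => h2 ⟨?_, hb⟩⟩
  · subst ha; exact eq_lastMate hP hj hab
  · subst hb; exact eq_lastMate hP hj (hP.symm _ _ hab)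

/-- ★★★ **`gonNext` IS THE ROTATION OF THE `(k+1)`-GON** `0 → 1 → ⋯ → k−1 → * → 0` on the closed-up matchings: `closeUp (gonNext q) = relMap (finRotate (k+1)) (closeUp q)`.
[cite: KhristoforovSmirnov2021, §1.2 (arXiv v1 p. 2: link patterns, cyclic indexing)] -/
theorem closeUp_gonNext (q : Pat₀ (n + 1)) : (closeUp (gonNext q)).1 = relMap (rot (n + 1 + 1)) (closeUp q).1 := by
  have hP : IsPattern q.1.1.1 q.1.1.2 := q.1.2
  rw [closeUp_val, closeUp_val, relMap_withPair, rot_star]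
  by_cases hj : q.1.1.1 = Fin.last n
  · -- the disorder's partner is the last mark: no crossing is created
    have h1 : (gonNext q).1.1 = (0, relMap (rot (n + 1)) q.1.1.2) := by
      rw [gonNext_of_eq q hj, rotPat_val, hj, rot_last]
    have hL : ∀ ab ∈ q.1.1.2, ab.1 ≠ Fin.last n ∧ ab.2 ≠ Fin.last n := by rw [← hj]; exact hP.avoids
    rw [show (gonNext q).1.1.1 = 0 from congrArg Prod.fst h1, show (gonNext q).1.1.2 = _ from congrArg Prod.snd h1, hj,
      rot_castSucc_last, liftRel_relMap_rot hL, Fin.castSucc_zero, withPair_comm]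
  · -- the chord `{k−1, d}` of the last mark becomes `{*, d+1}`, the disorder's chord `{*, j}` becomes `{0, j+1}`
    have hd := lastMate_mem hP hj
    have hdl := lastMate_ne_last hP hj
    have h1 := gonNext_val_of_ne q hj
    have hL' := strip_avoids_last hP hj
    rw [show (gonNext q).1.1.1 = _ from congrArg Prod.fst h1, show (gonNext q).1.1.2 = _ from congrArg Prod.snd h1]
    conv_rhs => rw [← withPair_strip_braid hd (hP.symm _ _ hd)]
    rw [← rot_last (n := n), ← relMap_strip, liftRel_withPair, liftRel_withPair, relMap_withPair, liftRel_relMap_rot hL',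
      rot_castSucc hdl, rot_castSucc_last, rot_castSucc hj, rot_last, Fin.castSucc_zero, withPair_right_comm,
      withPair_comm _ (0 : Fin (n + 1 + 1))]

/-- ★ **the polygon successor map is injective** (it is conjugate, by `closeUp`, to the rotation of the `(k+1)`-gon).
[cite: KhristoforovSmirnov2021, §1.2 (arXiv v1 p. 2: link patterns, cyclic indexing)] -/
theorem gonNext_injective : Function.Injective (gonNext (n := n)) := by
  intro q q' h
  have h1 := closeUp_gonNext q
  have h2 := closeUp_gonNext q'
  rw [h] at h1
  have h3 : relMap (rot (n + 1 + 1)) (closeUp q).1 = relMap (rot (n + 1 + 1)) (closeUp q').1 := h1.symm.trans h2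
  have h4 : (closeUp q).1 = (closeUp q').1 := by
    have := congrArg (relMap (rot (n + 1 + 1)).symm) h3
    rwa [relMap_symm_relMap, relMap_symm_relMap] at this
  have h5 : pat₀EquivNCMatching (n + 1) q = pat₀EquivNCMatching (n + 1) q' := Subtype.ext h4
  exact (pat₀EquivNCMatching (n + 1)).injective h5

/-- ★ **the polygon successor map is a PERMUTATION of the outermost patterns** (the rotation of the `(k+1)`-gon read through `closeUp`).
[cite: KhristoforovSmirnov2021, §1.2 (arXiv v1 p. 2: link patterns, cyclic indexing)] -/
theorem gonNext_bijective : Function.Bijective (gonNext (n := n)) :=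
  ⟨gonNext_injective, Finite.injective_iff_surjective.1 gonNext_injective⟩

/-- ★ **iterating the polygon successor = the powers of the polygon rotation** (through `closeUp`).
[cite: KhristoforovSmirnov2021, §1.2 (arXiv v1 p. 2: link patterns, cyclic indexing)] -/
theorem closeUp_gonNext_iterate (m : ℕ) (q : Pat₀ (n + 1)) :
    (closeUp (gonNext^[m] q)).1 = relMap (rot (n + 1 + 1) ^ m) (closeUp q).1 := by
  induction m generalizing q with
  | zero => rw [Function.iterate_zero, id, pow_zero]; exact (relMap_refl _).symm
  | succ m ih =>
    rw [Function.iterate_succ_apply', closeUp_gonNext, ih, ← relMap_trans, pow_succ', Equiv.Perm.mul_def]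

/-- the polygon rotation has order `k+1` on the labels. [cite: KhristoforovSmirnov2021, §1.2 (arXiv v1 p. 2: cyclic indexing)] -/
theorem rot_pow_polygon : rot (n + 1 + 1) ^ (n + 1 + 1) = 1 := by
  ext x
  rw [val_rot_pow, Equiv.Perm.one_apply, Nat.add_mod_right, Nat.mod_eq_of_lt x.2]

/-- ★★ **A HIDDEN `ℤ/(k+1)` ON THE OUTERMOST BASIS**: the polygon successor has order dividing `k+1` — `gonNext^[k+1] = id` — although the mark rotation it
twists (`solWRot_apply_outermost`) has order `k`. [cite: KhristoforovSmirnov2021, §1.2 (arXiv v1 p. 2: link patterns, cyclic indexing)] -/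
theorem gonNext_iterate_polygon (q : Pat₀ (n + 1)) : gonNext^[n + 1 + 1] q = q := by
  have h := closeUp_gonNext_iterate (n + 1 + 1) q
  rw [rot_pow_polygon] at h
  have h' : pat₀EquivNCMatching (n + 1) (gonNext^[n + 1 + 1] q) = pat₀EquivNCMatching (n + 1) q :=
    Subtype.ext (h.trans (relMap_refl _))
  exact (pat₀EquivNCMatching (n + 1)).injective h'

/-- **THE TEMPERLEY–LIEB GENERATOR `e_{*,0}` AS A RELATION OPERATION**: keep the chords avoiding `*` and `0`, cap the edge `{*, 0}`, and join `a` with `b`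
(to be used with `a`, `b` the former partners of `*` and `0`). [cite: KhristoforovSmirnov2021, §1.2 (arXiv v1 p. 2: link patterns)] -/
def tlCapRel (M : Finset (Fin (n + 1 + 1) × Fin (n + 1 + 1))) (a b : Fin (n + 1 + 1)) : Finset (Fin (n + 1 + 1) × Fin (n + 1 + 1)) :=
  withPair (withPair (M.filter fun p => p.1 ≠ Fin.last (n + 1) ∧ p.1 ≠ 0 ∧ p.2 ≠ Fin.last (n + 1) ∧ p.2 ≠ 0) (Fin.last (n + 1)) 0) a b

/-- ★ **THE TEMPERLEY–LIEB GENERATOR `e_{*,0}` ON THE NON-CROSSING MATCHINGS OF THE `(k+1)`-GON** (loop weight one: a matching already containing the cap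
`{*, 0}` is fixed, `tlCap_of_mem`). [cite: KhristoforovSmirnov2021, §1.2 (arXiv v1 p. 2: link patterns)] -/
noncomputable def tlCap (M : NCMatching (n + 1 + 1)) : Finset (Fin (n + 1 + 1) × Fin (n + 1 + 1)) :=
  tlCapRel M.1 (M.2.partner (Fin.last (n + 1))) (M.2.partner 0)

/-- ★ **loop weight one**: a matching containing the cap `{*, 0}` is FIXED by `e_{*,0}` (no factor). [cite: KhristoforovSmirnov2021, §1 (arXiv v1 p. 1: the `O(1)` model)] -/
theorem tlCap_of_mem (M : NCMatching (n + 1 + 1)) (h : (Fin.last (n + 1), (0 : Fin (n + 1 + 1))) ∈ M.1) : tlCap M = M.1 := by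
  have hN := M.2
  have ha : hN.partner (Fin.last (n + 1)) = 0 := (hN.eq_partner h).symm
  have hb : hN.partner 0 = Fin.last (n + 1) := (hN.eq_partner (hN.symm _ _ h)).symm
  unfold tlCap tlCapRel
  rw [ha, hb]
  ext ⟨x, y⟩
  rw [mem_withPair, mem_withPair, Finset.mem_filter]
  constructor
  · rintro (⟨rfl, rfl⟩ | ⟨rfl, rfl⟩ | ⟨rfl, rfl⟩ | ⟨rfl, rfl⟩ | ⟨hxy, -⟩)
    · exact hN.symm _ _ h
    · exact h
    · exact h
    · exact hN.symm _ _ h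
    · exact hxy
  · intro hxy
    by_cases hx : x = Fin.last (n + 1)
    · subst hx
      exact Or.inr (Or.inr (Or.inl ⟨rfl, by rw [hN.eq_partner hxy, ha]⟩))
    by_cases hx0 : x = 0
    · subst hx0
      exact Or.inl ⟨rfl, by rw [hN.eq_partner hxy, hb]⟩
    refine Or.inr (Or.inr (Or.inr (Or.inr ⟨hxy, hx, hx0, fun hy => hx0 ?_, fun hy => hx ?_⟩)))
    · subst hy; rw [hN.eq_partner (hN.symm _ _ hxy), ha]
    · subst hy; rw [hN.eq_partner (hN.symm _ _ hxy), hb]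

/-- the chords avoiding `*` and `0` of a matching `X + {0, u} + {v, *}` with `X` avoiding both. [folklore] -/
private theorem filter_polygon (X : Finset (Fin (n + 1 + 1) × Fin (n + 1 + 1)))
    (hX : ∀ p ∈ X, p.1 ≠ Fin.last (n + 1) ∧ p.1 ≠ 0 ∧ p.2 ≠ Fin.last (n + 1) ∧ p.2 ≠ 0) (u v : Fin (n + 1 + 1)) :
    (withPair (withPair X 0 u) v (Fin.last (n + 1))).filter
        (fun p => p.1 ≠ Fin.last (n + 1) ∧ p.1 ≠ 0 ∧ p.2 ≠ Fin.last (n + 1) ∧ p.2 ≠ 0) = X := by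
  ext ⟨x, y⟩
  rw [Finset.mem_filter, mem_withPair, mem_withPair]
  constructor
  · rintro ⟨h | h | h | h | h, h1, h2, h3, h4⟩
    · exact absurd h.2 h3
    · exact absurd h.1 h1
    · exact absurd h.1 h2
    · exact absurd h.2 h4
    · exact h
  · intro h
    exact ⟨Or.inr (Or.inr (Or.inr (Or.inr h))), hX _ h⟩

/-- a lifted relation avoids `*`; the lift of a rotated relation avoiding the last mark also avoids `0`. [cite: KhristoforovSmirnov2021, §1.2 (arXiv v1 p. 2)] -/
theorem liftRel_relMap_avoids {L : Finset (Fin (n + 1) × Fin (n + 1))} (hL : ∀ ab ∈ L, ab.1 ≠ Fin.last n ∧ ab.2 ≠ Fin.last n) :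
    ∀ p ∈ liftRel (relMap (rot (n + 1)) L), p.1 ≠ Fin.last (n + 1) ∧ p.1 ≠ 0 ∧ p.2 ≠ Fin.last (n + 1) ∧ p.2 ≠ 0 := by
  rintro ⟨x, y⟩ h
  obtain ⟨a', b', hab, rfl, rfl⟩ := mem_liftRel_braid.1 h
  rw [mem_relMap] at hab
  obtain ⟨ha, hb⟩ := hL _ hab
  refine ⟨(Fin.castSucc_lt_last _).ne, fun e => ha ?_, (Fin.castSucc_lt_last _).ne, fun e => hb ?_⟩
  · rw [Fin.castSucc_eq_zero_iff] at e
    rw [← rot_eq_zero_iff, Equiv.apply_symm_apply]; exact e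
  · rw [Fin.castSucc_eq_zero_iff] at e
    rw [← rot_eq_zero_iff, Equiv.apply_symm_apply]; exact e

/-- in the rotated closed-up matching, `*` is matched to `d+1` and `0` to `j+1` (`j ≠ k−1`). [cite: KhristoforovSmirnov2021, §1.2 (arXiv v1 p. 2)] -/
theorem partners_closeUp_gonNext (q : Pat₀ (n + 1)) (hj : q.1.1.1 ≠ Fin.last n) :
    (closeUp (gonNext q)).2.partner (Fin.last (n + 1)) = Fin.castSucc (rot (n + 1) (lastMate q.1.2 hj)) ∧
      (closeUp (gonNext q)).2.partner 0 = Fin.castSucc (rot (n + 1) q.1.1.1) := by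
  have h1 := gonNext_val_of_ne q hj
  have hM : (closeUp (gonNext q)).1 = withPair (liftRel (withPair (strip (relMap (rot (n + 1)) q.1.1.2) 0 (rot (n + 1) (lastMate q.1.2 hj)))
      0 (rot (n + 1) q.1.1.1))) (Fin.castSucc (rot (n + 1) (lastMate q.1.2 hj))) (Fin.last (n + 1)) := by
    rw [closeUp_val, show (gonNext q).1.1.1 = _ from congrArg Prod.fst h1, show (gonNext q).1.1.2 = _ from congrArg Prod.snd h1]
  constructor
  · symm
    apply (closeUp (gonNext q)).2.eq_partner
    rw [hM, mem_withPair]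
    exact Or.inr (Or.inl ⟨rfl, rfl⟩)
  · symm
    apply (closeUp (gonNext q)).2.eq_partner
    rw [hM, mem_withPair, liftRel_withPair, mem_withPair, Fin.castSucc_zero]
    exact Or.inr (Or.inr (Or.inl ⟨rfl, rfl⟩))

/-- ★★★ **`gonCap` IS THE TEMPERLEY–LIEB GENERATOR `e_{*,0}` APPLIED TO THE ROTATED MATCHING**: `closeUp (gonCap q) = tlCap (closeUp (gonNext q))` — cap the edge
`{*, 0}` of the `(k+1)`-gon and join the former partners. [cite: KhristoforovSmirnov2021, §1.2 (arXiv v1 p. 2: link patterns); §2 Lemma 4, Fig. 3 (p. 4)] -/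
theorem closeUp_gonCap (q : Pat₀ (n + 1)) : (closeUp (gonCap q)).1 = tlCap (closeUp (gonNext q)) := by
  have hP : IsPattern q.1.1.1 q.1.1.2 := q.1.2
  by_cases hj : q.1.1.1 = Fin.last n
  · -- the cap `{*, 0}` is already there: `e_{*,0}` fixes the matching (loop weight one)
    have hsame : gonCap q = gonNext q := Subtype.ext (by rw [gonCap_of_eq q hj, gonNext_of_eq q hj])
    have h1 : (gonNext q).1.1 = (0, relMap (rot (n + 1)) q.1.1.2) := by
      rw [gonNext_of_eq q hj, rotPat_val, hj, rot_last]
    have hmem : (Fin.last (n + 1), (0 : Fin (n + 1 + 1))) ∈ (closeUp (gonNext q)).1 := by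
      rw [closeUp_val, show (gonNext q).1.1.1 = 0 from congrArg Prod.fst h1, mem_withPair, Fin.castSucc_zero]
      exact Or.inr (Or.inl ⟨rfl, rfl⟩)
    rw [hsame, tlCap_of_mem _ hmem]
  · have h1 := gonCap_val_of_ne q hj
    have h2 := gonNext_val_of_ne q hj
    obtain ⟨pa, pb⟩ := partners_closeUp_gonNext q hj
    have hL' := strip_avoids_last hP hj
    have hX := liftRel_relMap_avoids hL'
    unfold tlCap
    rw [pa, pb, closeUp_val, closeUp_val, show (gonCap q).1.1.1 = _ from congrArg Prod.fst h1,
      show (gonCap q).1.1.2 = _ from congrArg Prod.snd h1, show (gonNext q).1.1.1 = _ from congrArg Prod.fst h2,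
      show (gonNext q).1.1.2 = _ from congrArg Prod.snd h2]
    unfold tlCapRel
    rw [← rot_last (n := n), ← relMap_strip, liftRel_withPair, liftRel_withPair, rot_last, Fin.castSucc_zero,
      filter_polygon _ hX, withPair_right_comm _ (Fin.castSucc _) (Fin.castSucc _) 0 (Fin.last (n + 1)),
      withPair_comm _ (0 : Fin (n + 1 + 1)) (Fin.last (n + 1)),
      withPair_comm _ (Fin.castSucc (rot (n + 1) q.1.1.1)) (Fin.castSucc (rot (n + 1) (lastMate hP hj)))]

/-- ★★★ **SUMMARY — THE MARK ROTATION IS THE TEMPERLEY–LIEB BRAID GENERATOR TIMES THE POLYGON ROTATION.** For every tripod-law solution `w` and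
every outermost pattern `q` (= non-crossing matching `closeUp q` of the `(k+1)`-gon): `(w ∘ patMap rot)(q) = A⁻¹·w(gonNext q) + A·w(gonCap q)` with
`A = −τ²`, `A⁻¹ = −τ`, where `closeUp (gonNext q)` is the ROTATED matching and `closeUp (gonCap q)` is `e_{*,0}` of it — i.e. `rot = ρᵀ ∘ (A⁻¹·1 + A·e_{*,0})ᵀ`
in the link basis, the Temperley–Lieb (Jones) braid generator at loop weight one composed with the rotation of the polygon.
[cite: KhristoforovSmirnov2021, §2 Lemma 4, proof and Fig. 3 (arXiv v1 p. 4); §1.2 (p. 2: link patterns, cyclic indexing)] -/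
theorem solWRot_eq_braid (w : solW (n + 1)) (q : Pat₀ (n + 1)) :
    (solWRot (n + 1) (rot (n + 1)) isCyc_rot w : Pat (n + 1) → ℂ) q.1 = (-tau) * w.1 (gonNext q).1 + (-tau ^ 2) * w.1 (gonCap q).1 ∧
      (closeUp (gonNext q)).1 = relMap (rot (n + 1 + 1)) (closeUp q).1 ∧ (closeUp (gonCap q)).1 = tlCap (closeUp (gonNext q)) :=
  ⟨solWRot_apply_outermost w q, closeUp_gonNext q, closeUp_gonCap q⟩

end Polygon

end Literature.Probability.Percolation.MarkedLoops
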